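import Summits.FinalStateConjecture.FinalStateConjecture.Theorems.SwallowTheDatumKerrShieldedSettlesStubCollarCauchy
import Literature.Geometry.Lorentzian.KerrDataProofs
import HarnessLib

/-!
# Crux `PhaseMixingCapture.NearExtremalKappaCapture` (stmt-FinalStateConjecture-10606), line
# `unit-temperature-front-face`, helper for stub S3 `stub_thermalTimeStability`, part 1: the slice `{t* = 0}`
# is a Cauchy hypersurface of the Kerr slab `{0 < t* + (r − M)/4}` (chart form)

Stub S3 (`stub_thermalTimeStability`, anchored thermal-time Cauchy stability of the maximal developments of
near-Kerr data on the Kerr–Schild slice `Kerr.slice a M = {t* = 0, r > M}`) needs, already at the centre of its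
data ball, a vacuum Cauchy development of the EXACT Kerr data realised inside the ingoing Kerr–Schild chart and
containing the whole half-chart `{t* ≥ 0}`. This part supplies the chart-level objects (part 2,
`PhaseMixingCaptureNearExtremalKappaCaptureThermalTimeStabilityCentre.lean`, assembles the development and proves
the centre case of S3):

* `KerrSlab.domain a M = {x ∈ Kerr.region a M | 0 < x⁰ + (r x − M)/4}` — an open, CONNECTED neighbourhood of
  the slice containing `{t* ≥ 0}` (`mem_domain_of_nonneg`, `isConnected_domain`), with slice membership
  `x⁰ = 0` (`exists_sliceEmbed_eq_iff`);
* `KerrSlab.cauchy_chart` — for `0 ≤ M`, `|a| < M`, every future-timelike chart curve on an order-connected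
  nonempty parameter set, lying in the slab domain and without future/past endpoint in it, meets `{x⁰ = 0}`
  exactly once.

The Cauchy property is ORDER THEORY of three clocks along future timelike chart curves, exactly as in the landed
`SwallowTheDatum.KerrShieldedSettles.stub_collarCauchy` (bent leaf `{x⁰ = T(r)}`; here the flat leaf `T ≡ 0`
and inner radius `r₁ = M ∈ (r₋, r₊)`): `t*` is strictly increasing and the coordinate curve is
Minkowski-timelike (`CollarCauchy.minkowski_curve`: the cones of `g = η + 2Hℓ⊗ℓ`, `H ≥ 0`, lie inside those of
`η`), `w = t* + (r − M)/4` is strictly increasing (`CollarCauchy.clock_pos` with the constant slope `−1/4`: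
`strictMonoOn_w`), and `r` is strictly decreasing in the hole `r₋ < r < r₊` (`CollarCauchy.strictAntiOn_radius`);
a curve missing the leaf lies below it (then `t* < 0` is bounded above: future endpoint `q` in `E4` with
`w(q) > 0 ≥ q⁰`, so `r(q) > M` and `q ∈ domain`) or above it (then `t* > 0` is bounded below: past endpoint `q`
with `q⁰ ≥ 0`, `r(q) ≥ M`; `r(q) > M` puts `q` in the domain, `r(q) = M < r₊` is excluded by the hole clock).
In particular `{t* ≥ 0} ∩ {r > M}` lies in the future Cauchy development of the slice: the future light cone of
the edge sphere `{t* = 0, r = M}` leaves `{r > M}` at once. No named fact is consumed.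

References: B. O'Neill, *Semi-Riemannian geometry* (1983), Ch. 14, Def. 14.28; S. W. Hawking, G. F. R. Ellis
(1973), §6.2, §6.5; M. Dafermos, I. Rodnianski, arXiv:0811.0354, §5.1; B. O'Neill, *The geometry of Kerr
black holes* (1995), Ch. 2 (`r` is a time function between the horizons).
-/

set_option linter.dupNamespace false

noncomputable section

open Set Filter Function TopologicalSpace Topology
open scoped Manifold ContDiff Topology
open Literature.Geometry.Lorentzian
open Summit.FinalStateConjecture.FinalStateConjecture.Theorems.SwallowTheDatum.KerrShieldedSettles.CollarCauchy
  (minkowski_curve curve_velocity hasDerivAt_radius_comp strictAntiOn_radius clock_pos sq_le_blSigma_spatial)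

namespace Summit.FinalStateConjecture.FinalStateConjecture.Theorems.NearExtremalKappaCapture.UnitTemperatureFrontFace

namespace KerrSlab

variable {M a : ℝ}

/-! ## The slab domain `{0 < x⁰ + (r − M)/4}` of the chart `Kerr.region a M` -/

/-- **The slab domain** `{x ∈ Kerr.region a M | 0 < x⁰ + (r x − M)/4}`: the half-chart `{t* ≥ 0}` plus a
past collar tapering to zero thickness at the inner edge `r = M`; an open subset of the chart (continuity of
`r`). Adapted from `CollarEmbedsMGHD.collar` (bent height `T ≡ 0`, inner radius `M`).
[cite: arXiv08110354, §5.1] -/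
def domain (a M : ℝ) : Opens (Kerr.region a M) :=
  ⟨{x | 0 < (x : E4) 0 + (Kerr.radius a (x : E4) - M) / 4}, by
    have h0 : Continuous fun x : E4 ↦ x 0 := PiLp.continuous_apply 2 _ 0
    have hc : Continuous fun x : E4 ↦ x 0 + (Kerr.radius a x - M) / 4 :=
      h0.add (((Kerr.continuous_radius a).sub continuous_const).div_const _)
    exact isOpen_lt continuous_const (hc.comp continuous_subtype_val)⟩

/-- Membership in the slab domain (by `Iff.rfl`). [folklore] -/
theorem mem_domain {x : Kerr.region a M} :
    x ∈ domain a M ↔ 0 < (x : E4) 0 + (Kerr.radius a (x : E4) - M) / 4 :=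
  Iff.rfl

/-- Chart points have `r > M`. [folklore] -/
theorem lt_radius (x : Kerr.region a M) : M < Kerr.radius a (x : E4) :=
  Kerr.lt_radius_of_mem_region x.2

/-- **The half-chart `{t* ≥ 0}` lies in the slab domain.** [folklore] -/
theorem mem_domain_of_nonneg {x : Kerr.region a M} (hx : 0 ≤ (x : E4) 0) : x ∈ domain a M := by
  rw [mem_domain]
  have := lt_radius x
  linarith

/-- The slice `{t* = 0}` lies in the slab domain. [folklore] -/
theorem sliceEmbed_mem_domain (y : Kerr.slice a M) : Kerr.sliceEmbed a M y ∈ domain a M :=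
  mem_domain_of_nonneg (by rw [Kerr.coe_sliceEmbed a M y, E4.ofTimeSpace_apply_zero])

/-- **A chart point lies on the slice `{t* = 0}` iff `x⁰ = 0`.** [folklore] -/
theorem exists_sliceEmbed_eq_iff {x : Kerr.region a M} :
    (∃ y, Kerr.sliceEmbed a M y = x) ↔ (x : E4) 0 = 0 := by
  constructor
  · rintro ⟨y, rfl⟩
    rw [Kerr.coe_sliceEmbed, E4.ofTimeSpace_apply_zero]
  · intro hx
    have hy : E4.spatial (x : E4) ∈ Kerr.slice a M := by
      rw [Kerr.mem_slice, Kerr.radius_ofTimeSpace_spatial]; exact x.2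
    refine ⟨⟨E4.spatial (x : E4), hy⟩, Subtype.ext ?_⟩
    rw [Kerr.coe_sliceEmbed]
    change E4.ofTimeSpace 0 (E4.spatial (x : E4)) = (x : E4)
    conv_rhs => rw [← E4.ofTimeSpace_time_spatial (x : E4)]
    rw [E4.time_apply, hx]

/-- The parametrisation `(σ, y) ↦ (−(r y − M)/4 + e^σ, y)` of the slab domain by `ℝ × slice`. [folklore] -/
def param (a M : ℝ) (p : ℝ × Kerr.slice a M) : Kerr.region a M :=
  ⟨E4.ofTimeSpace (-((Kerr.radius a (E4.ofTimeSpace 0 (p.2 : E3)) - M) / 4) + Real.exp p.1) (p.2 : E3),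
    Kerr.ofTimeSpace_mem_region_iff.2 p.2.2⟩

/-- Unfolding lemma for `param`. [folklore] -/
theorem coe_param (p : ℝ × Kerr.slice a M) :
    (param a M p : E4) =
      E4.ofTimeSpace (-((Kerr.radius a (E4.ofTimeSpace 0 (p.2 : E3)) - M) / 4) + Real.exp p.1) (p.2 : E3) :=
  rfl

/-- The parametrisation of the slab domain is continuous. [folklore] -/
theorem continuous_param : Continuous (param a M) := by
  refine Continuous.subtype_mk ?_ _
  have hof : Continuous fun q : ℝ × E3 ↦ E4.ofTimeSpace q.1 q.2 := by
    have : (fun q : ℝ × E3 ↦ E4.ofTimeSpace q.1 q.2) = fun q ↦ q.1 • E4.basisVector 0 + E4.spaceEmbed q.2 :=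
      funext fun q ↦ E4.ofTimeSpace_eq_smul_add' _ _
    rw [this]
    exact (continuous_fst.smul continuous_const).add (E4.spaceEmbed.continuous.comp continuous_snd)
  have hr : Continuous fun p : ℝ × Kerr.slice a M ↦ Kerr.radius a (E4.ofTimeSpace 0 (p.2 : E3)) :=
    (Kerr.continuous_radius a).comp
      ((E4.continuous_ofTimeSpace 0).comp (continuous_subtype_val.comp continuous_snd))
  exact hof.comp (((((hr.sub continuous_const).div_const _).neg).add
    (Real.continuous_exp.comp continuous_fst)).prodMk (continuous_subtype_val.comp continuous_snd))

/-- The slab domain is the range of its parametrisation. [folklore] -/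
theorem range_param : range (param a M) = (domain a M : Set (Kerr.region a M)) := by
  ext x
  constructor
  · rintro ⟨p, rfl⟩
    rw [SetLike.mem_coe, mem_domain, coe_param, E4.ofTimeSpace_apply_zero,
      Kerr.radius_ofTimeSpace a (_ + Real.exp p.1)]
    have := Real.exp_pos p.1
    linarith
  · intro hx
    rw [SetLike.mem_coe, mem_domain] at hx
    have hy : E4.spatial (x : E4) ∈ Kerr.slice a M := by
      rw [Kerr.mem_slice, Kerr.radius_ofTimeSpace_spatial]; exact x.2
    refine ⟨(Real.log ((x : E4) 0 + (Kerr.radius a (x : E4) - M) / 4), ⟨E4.spatial (x : E4), hy⟩),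
      Subtype.ext ?_⟩
    rw [coe_param]
    change E4.ofTimeSpace (-((Kerr.radius a (E4.ofTimeSpace 0 (E4.spatial (x : E4))) - M) / 4) +
        Real.exp (Real.log ((x : E4) 0 + (Kerr.radius a (x : E4) - M) / 4))) (E4.spatial (x : E4)) = (x : E4)
    rw [Kerr.radius_ofTimeSpace_spatial, Real.exp_log hx]
    conv_rhs => rw [← E4.ofTimeSpace_time_spatial (x : E4)]
    congr 1
    rw [E4.time_apply]
    ring

/-- **The slab domain is connected**: it is the continuous image of the connected space `ℝ × slice`
(`Kerr.isConnected_slice_holds`). [cite: ONeill1995, Ch. 2 §2.1] -/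
theorem isConnected_domain : IsConnected (domain a M : Set (Kerr.region a M)) := by
  haveI : ConnectedSpace (Kerr.slice a M) :=
    isConnected_iff_connectedSpace.mp (Kerr.isConnected_slice_holds a M)
  rw [← range_param]
  exact isConnected_range continuous_param

/-! ## The clock `w = t* + (r − M)/4` along future timelike chart curves -/

/-- **Numerator of the `w`-clock** (slope `−¼`): `−Σ + (r² + a²)/16 − (9/8)Mr < 0` at every point with
`r > M > |a|` (`Σ ≥ r² > a²`). [folklore] -/
theorem numerator_quarter_neg (ha : |a| < M) {x : E4} (hx : 0 < Kerr.radius a x) (hMx : M < Kerr.radius a x) :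
    -Kerr.blSigma a (E4.spatial x) + (-(1 / 4 : ℝ)) ^ 2 * (Kerr.radius a x ^ 2 + a ^ 2) -
      2 * M * Kerr.radius a x * (1 + -(1 / 4 : ℝ)) ^ 2 < 0 := by
  have hSig := sq_le_blSigma_spatial hx
  have hM : 0 ≤ M := le_trans (abs_nonneg a) ha.le
  have ha2 : a ^ 2 < Kerr.radius a x ^ 2 := by
    have h1 : |a| < Kerr.radius a x := ha.trans hMx
    have h2 : 0 ≤ |a| := abs_nonneg a
    nlinarith [sq_abs a]
  nlinarith [mul_nonneg hM hx.le, mul_pos hx hx]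

/-- **`w = t* + (r − M)/4` is strictly increasing along future timelike curves** of the chart `Kerr.region a M`
(`CollarCauchy.clock_pos` with the slope `−¼`, mean value theorem). Adapted from `CollarCauchy.strictMonoOn_w`.
[folklore] -/
theorem strictMonoOn_w [Kerr.Facts] (hM : 0 ≤ M) (ha : |a| < M) {γ : ℝ → Kerr.region a M} {s : Set ℝ}
    (hs : s.OrdConnected)
    (hγ : (Kerr.smoothMetric M a M).IsFutureTimelikeCurveOn ((Kerr.timeOrientation M a M hM).ofLE le_top) γ s) :
    StrictMonoOn (fun σ => (γ σ : E4) 0 + (Kerr.radius a (γ σ) - M) / 4) s := by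
  have hder : ∀ t ∈ s, HasDerivAt (fun σ => (γ σ : E4) 0 + (Kerr.radius a (γ σ) - M) / 4)
      (deriv (fun σ => (γ σ : E4)) t 0 - (-(1 / 4 : ℝ)) *
        Kerr.radiusGrad a (E4.spatial (γ t : E4)) (E4.spatial (deriv (fun σ => (γ σ : E4)) t))) t := by
    intro t ht
    refine ((Minkowski.hasDerivAt_time (minkowski_curve hγ) ht).add
      (((hasDerivAt_radius_comp hγ ht).sub_const M).div_const 4)).congr_deriv ?_
    ring
  refine strictMonoOn_of_deriv_pos hs.convex
    (fun t ht => (hder t ht).continuousAt.continuousWithinAt) fun t ht => ?_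
  have ht' := interior_subset ht
  rw [(hder t ht').deriv]
  obtain ⟨-, htl, hfd⟩ := curve_velocity hγ ht'
  have hx : 0 < Kerr.radius a (γ t) := Kerr.radius_pos_of_mem_region (γ t).2
  have hMx : M < Kerr.radius a (γ t) := lt_radius (γ t)
  have hH := Kerr.scalarH_nonneg hM a (γ t : E4)
  exact clock_pos hM hx (numerator_quarter_neg ha hx hMx) (by nlinarith) htl.le
    (fun h0 => by rw [h0] at htl; simp at htl) hfd

/-! ## The slice is a Cauchy hypersurface of the slab domain (chart form) -/

/-- **The slice `{t* = 0}` is a Cauchy hypersurface of the slab domain, chart form**: for `0 ≤ M`, `|a| < M`,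
every future-timelike chart curve `γ` on an order-connected nonempty parameter set `s`, lying in the slab
domain on `s` and without future/past endpoint in the domain, meets `{x⁰ = 0}` exactly once. Order theory of
the clocks `t*`, `w = t* + (r − M)/4` (strictly increasing) and the hole clock (`r` strictly decreasing on
`r₋ < r < r₊`), with the Kerr–Schild speed limit; adapted from `SwallowTheDatum.KerrShieldedSettles.stub_collarCauchy`
(bent height `T ≡ 0`, inner radius `M`). [cite: ONeillSemiRiemannian1983, Ch. 14, Def. 14.28 (p. 415)] -/
theorem cauchy_chart [Kerr.Facts] (hM : 0 ≤ M) (ha : |a| < M) (γ : ℝ → Kerr.region a M) (s : Set ℝ)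
    (hs : s.OrdConnected) (hne : s.Nonempty)
    (hγ : (Kerr.smoothMetric M a M).IsFutureTimelikeCurveOn ((Kerr.timeOrientation M a M hM).ofLE le_top) γ s)
    (hW : ∀ t ∈ s, γ t ∈ domain a M)
    (hend : ∀ q : Kerr.region a M, q ∈ domain a M → ¬ HasFutureEndpoint γ s q ∧ ¬ HasPastEndpoint γ s q) :
    ∃! t, t ∈ s ∧ (γ t : E4) 0 = 0 := by
  haveI : Nonempty s := hne.to_subtype
  have hβ := minkowski_curve hγ
  have hu : StrictMonoOn (fun σ => (γ σ : E4) 0) s := Minkowski.strictMonoOn_time hs hβ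
  have hr₁ : ∀ σ, M < Kerr.radius a (γ σ) := fun σ => lt_radius (γ σ)
  have hsq : 0 < √(M ^ 2 - a ^ 2) :=
    Real.sqrt_pos.2 (by nlinarith [abs_nonneg a, sq_abs a, abs_lt.1 ha])
  have h₁ : Kerr.rMinus M a < M := by rw [Kerr.rMinus]; linarith
  have h₂ : M < Kerr.rPlus M a := by rw [Kerr.rPlus]; linarith
  have h0t : Continuous fun p : E4 => p 0 := PiLp.continuous_apply 2 _ 0
  have hmem : ∀ q : E4, M < Kerr.radius a q → q ∈ Kerr.region a M := fun q hq => by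
    rw [Kerr.mem_region, max_eq_left hM]; exact hq
  -- uniqueness by monotonicity of `t*`; existence is what remains
  suffices hex : ∃ t ∈ s, (γ t : E4) 0 = 0 by
    obtain ⟨t, ht, ht0⟩ := hex
    refine ⟨t, ⟨ht, ht0⟩, ?_⟩
    rintro t' ⟨ht', ht'0⟩
    exact hu.injOn ht' ht (ht'0.trans ht0.symm)
  by_contra hno
  push Not at hno
  obtain ⟨t₀, ht₀⟩ := hne
  have hcont : ContinuousOn (fun σ => (γ σ : E4) 0) s :=
    fun t ht => (Minkowski.hasDerivAt_time hβ ht).continuousAt.continuousWithinAt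
  rcases lt_or_gt_of_ne (hno t₀ ht₀) with hneg | hpos
  · /- the curve lies below the leaf (`t* < 0` on `s`, intermediate value theorem): futureward escape. `t*`
      is bounded above by `0`, so the curve has a future endpoint `q` in `E4`; `w(q) ≥ w(t₀) > 0` and `q⁰ ≤ 0`
      force `r(q) > M`, so `q` lies in the domain: contradiction. -/
    have hall : ∀ t ∈ s, (γ t : E4) 0 < 0 := by
      intro t ht
      by_contra hge
      push Not at hge
      obtain ⟨c, hc, hc0⟩ := hs.isPreconnected.intermediate_value ht₀ ht hcont ⟨hneg.le, hge⟩
      exact hno c hc hc0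
    have hbdd : BddAbove ((fun σ => (γ σ : E4) 0) '' s) := by
      refine ⟨0, ?_⟩
      rintro _ ⟨σ, hσ, rfl⟩
      exact (hall σ hσ).le
    obtain ⟨q, hq⟩ : ∃ q : E4, HasFutureEndpoint (fun σ => (γ σ : E4)) s q := by
      by_contra hcon
      push Not at hcon
      exact Minkowski.not_bddAbove_time hs hβ ⟨⟨t₀, ht₀⟩, hcon⟩ hbdd
    have hqr : Tendsto (fun σ : s => Kerr.radius a (γ σ)) atTop (𝓝 (Kerr.radius a q)) :=
      ((Kerr.continuous_radius a).tendsto q).comp hq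
    have hq0 : Tendsto (fun σ : s => (γ σ : E4) 0) atTop (𝓝 (q 0)) := (h0t.tendsto q).comp hq
    have hw := strictMonoOn_w hM ha hs hγ
    have hwq : (γ t₀ : E4) 0 + (Kerr.radius a (γ t₀) - M) / 4 ≤ q 0 + (Kerr.radius a q - M) / 4 := by
      refine ge_of_tendsto (hq0.add ((hqr.sub_const M).div_const 4)) ?_
      filter_upwards [eventually_ge_atTop (⟨t₀, ht₀⟩ : s)] with σ hσ
      exact hw.monotoneOn ht₀ σ.2 hσ
    have huq : q 0 ≤ 0 := le_of_tendsto' hq0 fun σ => (hall σ σ.2).le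
    have hW₀ := hW t₀ ht₀
    rw [mem_domain] at hW₀
    have hrq : M < Kerr.radius a q := by linarith
    have hq' : HasFutureEndpoint γ s ⟨q, hmem q hrq⟩ :=
      (hasFutureEndpoint_subtypeVal_comp_iff (p := ⟨q, hmem q hrq⟩)).1 hq
    exact (hend ⟨q, hmem q hrq⟩
      (by rw [mem_domain]; change 0 < q 0 + (Kerr.radius a q - M) / 4; linarith)).1 hq'
  · /- the curve lies above the leaf (`t* > 0` on `s`): pastward escape. `t* > 0` is bounded below, so the
      curve has a past endpoint `q` in `E4` with `q⁰ ≥ 0`, `r(q) ≥ M`; if `r(q) > M` then `q` lies in the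
      domain, contradiction; if `r(q) = M < r₊` the hole clock makes `r` increase pastward near the endpoint,
      contradiction. -/
    have hall : ∀ t ∈ s, 0 < (γ t : E4) 0 := by
      intro t ht
      by_contra hle
      push Not at hle
      obtain ⟨c, hc, hc0⟩ := hs.isPreconnected.intermediate_value ht ht₀ hcont ⟨hle, hpos.le⟩
      exact hno c hc hc0
    have hbdd : BddBelow ((fun σ => (γ σ : E4) 0) '' s) := by
      refine ⟨0, ?_⟩
      rintro _ ⟨σ, hσ, rfl⟩
      exact (hall σ hσ).le
    obtain ⟨q, hq⟩ : ∃ q : E4, HasPastEndpoint (fun σ => (γ σ : E4)) s q := by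
      by_contra hcon
      push Not at hcon
      exact Minkowski.not_bddBelow_time hs hβ ⟨⟨t₀, ht₀⟩, hcon⟩ hbdd
    have hqr : Tendsto (fun σ : s => Kerr.radius a (γ σ)) atBot (𝓝 (Kerr.radius a q)) :=
      ((Kerr.continuous_radius a).tendsto q).comp hq
    have hq0 : Tendsto (fun σ : s => (γ σ : E4) 0) atBot (𝓝 (q 0)) := (h0t.tendsto q).comp hq
    have huq : 0 ≤ q 0 := ge_of_tendsto' hq0 fun σ => (hall σ σ.2).le
    have hrq₁ : M ≤ Kerr.radius a q := ge_of_tendsto' hqr fun σ => (hr₁ σ).le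
    rcases hrq₁.lt_or_eq with hrq | hrq
    · have hq' : HasPastEndpoint γ s ⟨q, hmem q hrq⟩ :=
        (hasPastEndpoint_subtypeVal_comp_iff (p := ⟨q, hmem q hrq⟩)).1 hq
      exact (hend ⟨q, hmem q hrq⟩
        (by rw [mem_domain]; change 0 < q 0 + (Kerr.radius a q - M) / 4; linarith)).2 hq'
    · have hev : ∀ᶠ σ : s in atBot, Kerr.radius a (γ σ) < Kerr.rPlus M a :=
        hqr.eventually (Iio_mem_nhds (by rw [← hrq]; exact h₂))
      obtain ⟨σ₁, hσ₁⟩ := hev.exists_forall_of_atBot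
      have hanti := strictAntiOn_radius ha h₁ (hs.inter ordConnected_Iic) inter_subset_left hγ
        (s' := s ∩ Iic (σ₁ : ℝ)) (fun σ hσ => hσ₁ ⟨σ, hσ.1⟩ hσ.2)
      have hge : ∀ᶠ σ : s in atBot, Kerr.radius a (γ σ₁) ≤ Kerr.radius a (γ σ) := by
        filter_upwards [eventually_le_atBot σ₁] with σ hσ
        exact hanti.antitoneOn ⟨σ.2, hσ⟩ ⟨σ₁.2, self_mem_Iic⟩ hσ
      have hle := ge_of_tendsto hqr hge
      linarith [hr₁ σ₁]


/-- **Registered sub-goal `stub_thermalTimeStabilitySlabCauchy` (of stub S3 `stub_thermalTimeStability`) — the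
slice `{t* = 0}` is a Cauchy hypersurface of the Kerr slab `{0 < t* + (r − M)/4}`, chart form.** For `0 ≤ M`,
`|a| < M`: every future-timelike chart curve of `Kerr.region a M` on an order-connected nonempty parameter set,
lying in `{0 < x⁰ + (r x − M)/4}` and without future/past endpoint there, meets `{x⁰ = 0}` exactly once
(`KerrSlab.cauchy_chart` with the slab domain unfolded). This is the Cauchy-hypersurface field of the Kerr slab
development of the exact Kerr data `Kerr.data M a M`, i.e. the centre case of S3.
[cite: ONeillSemiRiemannian1983, Ch. 14, Def. 14.28 (p. 415)] -/
theorem _root_.Summit.FinalStateConjecture.FinalStateConjecture.Theorems.NearExtremalKappaCapture.UnitTemperatureFrontFace.stub_thermalTimeStabilitySlabCauchy :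
    ∀ [Kerr.Facts] (M a : ℝ) (hM : 0 ≤ M), |a| < M → ∀ (γ : ℝ → Kerr.region a M) (s : Set ℝ),
    s.OrdConnected → s.Nonempty →
    (Kerr.smoothMetric M a M).IsFutureTimelikeCurveOn ((Kerr.timeOrientation M a M hM).ofLE le_top) γ s →
    (∀ t ∈ s, 0 < (γ t : E4) 0 + (Kerr.radius a (γ t : E4) - M) / 4) →
    (∀ q : Kerr.region a M, 0 < (q : E4) 0 + (Kerr.radius a (q : E4) - M) / 4 →
      ¬ HasFutureEndpoint γ s q ∧ ¬ HasPastEndpoint γ s q) →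
    ∃! t, t ∈ s ∧ (γ t : E4) 0 = 0 :=
  fun _ _ hM ha γ s hs hne hγ hW hend ↦ cauchy_chart hM ha γ s hs hne hγ hW hend

end KerrSlab

end Summit.FinalStateConjecture.FinalStateConjecture.Theorems.NearExtremalKappaCapture.UnitTemperatureFrontFace

end
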